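import Summits.KontsevichZagierPeriods.KontsevichZagierPeriods.Theorems.HurwitzMicroSectorsNormalFormPrincipleDlogMoves

/-!
# `NormalFormPrinciple` (stmt-KontsevichZagierPeriods-3869), line `SketchIdeator1` —
# registered sub-goal `nf_pole_one` (siege attempt k24: certificate on the finite core)

The sub-goal: a simple rational pole `T = [(0,1), c/(x − ρ)]`, `ρ ∈ ℚ ∖ [0,1]`, is congruent
modulo `KZ.relations` to the normal form "rational point + prime carriers",

  `[T] = [pt, r] + Σ_{p ∈ S} [(1,p), C_p / y]`,   `S` a finite set of primes.

Proof (four moves of the calculus, then a finite certificate):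

* **one affine move** (rule 2): the translation `y ↦ y + ρ` (`ρ < 0`) or the reflection
  `y ↦ ρ − y` (`ρ > 1`) carries the dlog window `[(a, a+1), ±c/y]`, `a = −ρ` resp. `a = ρ − 1 > 0`,
  onto `T`;
* **one dilation and one split** (rules 2, 1a): writing `a = A/D` with `A, D ∈ ℕ`,
  `[(a, a+1), c'/y] ≡ [(A, A+D), c'/y] ≡ Λ(A+D) − Λ(A)` with the integer carriers
  `Λ(n) := [(1,n), c'/y]`;
* **the finite core** (`eq_sum_primeFactors_of_map_mul`, pure algebra): any `Λ : ℕ → G` into an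
  abelian group with `Λ 1 = 0` and `Λ(mn) = Λ(m) + Λ(n)` (`m, n ≥ 1`) satisfies the certificate
  `Λ(n) = Σ_{p ∣ n} v_p(n) • Λ(p)`; for the carriers, `Λ 1 = 0` is the empty slab and
  `Λ(mn) = Λ(m) + Λ(n)` is one split at `m` plus the dilation `y ↦ m y` of `(1,n)` onto `(m,mn)`;
* **merging** (rule 1b): `c ↦ [(1,p), c/y]` is additive modulo relations, so
  `v • Λ(p) = [(1,p), v c'/y]`, and the point term is `[pt, 0] ∈ relations`.

All moves are the landed ones of `…NormalFormPrincipleDlogMoves.lean` (`split_mem_relations`,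
`dlog_scale_mem_relations`, `dlog_merge_mem_relations`, `slab_empty_mem_relations`) and the affine
chart lemmas of `TerasomaMultiplicationBetaCancellationStubAffineMove.lean`; the only arithmetic
input is unique factorisation (`Nat.factorization`). Classes in `FormalRep ⧸ relations` are
written as coercions `(x : FormalRep ⧸ relations)` (`QuotientAddGroup.mk'_apply`). No definitions
are introduced.

Sources: M. Kontsevich, D. Zagier, *Periods* (2001), §1.1 (`log 2 = ∫₁² dx/x`), §1.2 rules (1), (2).
-/

noncomputable section

open MeasureTheory Set
open Literature.NumberTheory.Transcendental Literature.NumberTheory.Transcendental.KZ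

namespace Summit.KontsevichZagierPeriods.HurwitzMicroSectors.NormalFormPrinciple.PiBox.Dlog.SiegeK24

open Summit.KontsevichZagierPeriods.KontsevichZagierPeriods.BetaCancellationLine
  (aff_hasFDerivAt_chart aff_abs_det_chartDeriv aff_injective_chart aff_isSemialgebraicMapOn_chart
    aff_image_chart)

/-! ## The finite core: the prime-carrier certificate of an additive function -/

/-- **The finite core.** A function `Λ : ℕ → G` into an abelian group with `Λ 1 = 0` and
`Λ (m n) = Λ m + Λ n` for `m, n ≥ 1` is certified on the primes:
`Λ n = Σ_{p ∈ primeFactors n} v_p(n) • Λ p` for `n ≥ 1` (unique factorisation). [folklore] -/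
theorem eq_sum_primeFactors_of_map_mul {G : Type*} [AddCommGroup G] (Λ : ℕ → G) (h1 : Λ 1 = 0)
    (hmul : ∀ m n : ℕ, 0 < m → 0 < n → Λ (m * n) = Λ m + Λ n) {n : ℕ} (hn : 0 < n) :
    Λ n = ∑ p ∈ n.primeFactors, n.factorization p • Λ p := by
  suffices H : ∀ n : ℕ, 0 < n → Λ n = n.factorization.sum fun p k => k • Λ p by
    rw [H n hn]
    simp only [Finsupp.sum, Nat.support_factorization]
  intro n
  induction n using induction_on_primes with
  | zero => exact fun h => absurd h (lt_irrefl 0)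
  | one =>
    intro
    rw [h1, Nat.factorization_one, Finsupp.sum_zero_index]
  | prime_mul p a hp ih =>
    intro hpa
    have ha : a ≠ 0 := by
      rintro rfl
      simp at hpa
    rw [hmul p a hp.pos (Nat.pos_of_ne_zero ha), ih (Nat.pos_of_ne_zero ha),
      Nat.factorization_mul hp.ne_zero ha, hp.factorization,
      Finsupp.sum_add_index' (h := fun q k => k • Λ q) (fun q => zero_nsmul (Λ q))
        (fun q k l => add_nsmul (Λ q) k l),
      Finsupp.sum_single_index (zero_nsmul (Λ p)), one_nsmul]

/-! ## The carriers `[(a,b), c/y]` modulo relations -/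

variable {R : ℚ → ℚ → ℚ → IntegralRep 1}

/-- The empty carrier `[(a,a), c/y]` is a relation. [cite: KontsevichZagier2001, §1.2 rule (1)] -/
theorem mk_carrier_self
    (hR : ∀ a b c, 0 < a → (R a b c).domain = {x | x 0 ∈ Set.Ioo (a:ℝ) b} ∧
      (R a b c).integrand = fun x => (c:ℝ) / x 0)
    {a : ℚ} (ha : 0 < a) (c : ℚ) : (of (R a a c) : FormalRep ⧸ relations) = 0 :=
  (QuotientAddGroup.eq_zero_iff _).mpr (slab_empty_mem_relations _ (hR a a c ha).1 le_rfl)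

/-- **Multiplicativity of the integer carriers** `Λ(n) = [(1,n), c/y]`:
`Λ(m n) = Λ(m) + Λ(n)` for `m, n ≥ 1` — one split of `(1, mn)` at `m` and the dilation
`y ↦ m y` of `(1, n)` onto `(m, mn)`. [cite: KontsevichZagier2001, §1.2 rules (1), (2)] -/
theorem mk_carrier_mul
    (hR : ∀ a b c, 0 < a → (R a b c).domain = {x | x 0 ∈ Set.Ioo (a:ℝ) b} ∧
      (R a b c).integrand = fun x => (c:ℝ) / x 0)
    (c : ℚ) {m n : ℕ} (hm : 0 < m) (hn : 0 < n) :
    (of (R 1 ((m * n : ℕ) : ℚ) c) : FormalRep ⧸ relations) =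
      (of (R 1 m c) : FormalRep ⧸ relations) + (of (R 1 n c) : FormalRep ⧸ relations) := by
  have hmq : (0:ℚ) < m := by exact_mod_cast hm
  -- split `(1, mn)` at `m`
  have hsplit : of (R 1 ((m * n : ℕ) : ℚ) c) - of (R 1 m c) - of (R m ((m * n : ℕ) : ℚ) c) ∈
      relations :=
    split_mem_relations _ _ _ (hR _ _ _ one_pos).1 (hR _ _ _ one_pos).1 (hR _ _ _ hmq).1
      (by exact_mod_cast Nat.one_le_iff_ne_zero.mpr hm.ne')
      (by exact_mod_cast Nat.le_mul_of_pos_right m hn)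
      (fun x _ => by rw [(hR _ _ _ one_pos).2, (hR _ _ _ one_pos).2])
      (fun x _ => by rw [(hR _ _ _ hmq).2, (hR _ _ _ one_pos).2])
  -- dilate `(1, n)` by `m` onto `(m, mn)`
  have hscale : of (R 1 n c) - of (R m ((m * n : ℕ) : ℚ) c) ∈ relations :=
    dlog_scale_mem_relations (s := (m:ℚ)) _ _ (hR _ _ _ one_pos).1
      (by rw [mul_one, ← Nat.cast_mul]; exact (hR _ _ _ hmq).1)
      (fun x _ => by rw [(hR _ _ _ one_pos).2]) (fun x _ => by rw [(hR _ _ _ hmq).2]) one_pos hmq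
  have h := (QuotientAddGroup.eq_zero_iff _).mpr hsplit
  rw [QuotientAddGroup.mk_sub, QuotientAddGroup.mk_sub, sub_sub, sub_eq_zero] at h
  rwa [QuotientAddGroup.eq_iff_sub_mem.mpr hscale]

/-- **Additivity of the carriers in the numerator** (merging, rule 1b):
`[(a,b), (c+c')/y] = [(a,b), c/y] + [(a,b), c'/y]` modulo relations.
[cite: KontsevichZagier2001, §1.2 rule (1)] -/
theorem mk_carrier_add
    (hR : ∀ a b c, 0 < a → (R a b c).domain = {x | x 0 ∈ Set.Ioo (a:ℝ) b} ∧
      (R a b c).integrand = fun x => (c:ℝ) / x 0)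
    {a : ℚ} (ha : 0 < a) (b c c' : ℚ) :
    (of (R a b (c + c')) : FormalRep ⧸ relations) =
      (of (R a b c) : FormalRep ⧸ relations) + (of (R a b c') : FormalRep ⧸ relations) := by
  have h := (QuotientAddGroup.eq_zero_iff _).mpr (dlog_merge_mem_relations (R a b (c + c'))
    (R a b c) (R a b c') (hR _ _ _ ha).1 (hR _ _ _ ha).1 (hR _ _ _ ha).1
    (fun x _ => by rw [(hR _ _ _ ha).2]) (fun x _ => by rw [(hR _ _ _ ha).2])
    (fun x _ => by rw [(hR _ _ _ ha).2]))
  rwa [QuotientAddGroup.mk_sub, QuotientAddGroup.mk_sub, sub_sub, sub_eq_zero] at h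

/-- The carrier class is `ℤ`-linear in the numerator: `[(a,b), (k − l) c / y] = k • [(a,b), c/y]
− l • [(a,b), c/y]` for `k, l ∈ ℕ`. [cite: KontsevichZagier2001, §1.2 rule (1)] -/
theorem mk_carrier_sub_natMul
    (hR : ∀ a b c, 0 < a → (R a b c).domain = {x | x 0 ∈ Set.Ioo (a:ℝ) b} ∧
      (R a b c).integrand = fun x => (c:ℝ) / x 0)
    {a : ℚ} (ha : 0 < a) (b c : ℚ) (k l : ℕ) :
    (of (R a b (((k:ℚ) - (l:ℚ)) * c)) : FormalRep ⧸ relations) =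
      k • (of (R a b c) : FormalRep ⧸ relations) - l • (of (R a b c) : FormalRep ⧸ relations) := by
  let μ : ℚ →+ FormalRep ⧸ relations :=
    AddMonoidHom.mk' (fun c => (of (R a b c) : FormalRep ⧸ relations)) (mk_carrier_add hR ha b)
  show μ (((k:ℚ) - (l:ℚ)) * c) = k • μ c - l • μ c
  rw [sub_mul, map_sub, ← nsmul_eq_mul, ← nsmul_eq_mul, map_nsmul, map_nsmul]

/-- **Integer carriers for a rational window**: for `0 < a ∈ ℚ`, writing `a = A/D`,
`[(a, a+1), c/y] = Λ(A + D) − Λ(A)` modulo relations (dilation by `D`, then one split of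
`(1, A+D)` at `A`). [cite: KontsevichZagier2001, §1.2 rules (1), (2)] -/
theorem exists_nat_window
    (hR : ∀ a b c, 0 < a → (R a b c).domain = {x | x 0 ∈ Set.Ioo (a:ℝ) b} ∧
      (R a b c).integrand = fun x => (c:ℝ) / x 0)
    {a c : ℚ} (ha : 0 < a) (L : IntegralRep 1)
    (hd : L.domain = {x | x 0 ∈ Set.Ioo (a:ℝ) ((a + 1 : ℚ):ℝ)})
    (hi : EqOn L.integrand (fun x => (c:ℝ) / x 0) L.domain) :
    ∃ A B : ℕ, 0 < A ∧ 0 < B ∧ (of L : FormalRep ⧸ relations) =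
      (of (R 1 B c) : FormalRep ⧸ relations) - (of (R 1 A c) : FormalRep ⧸ relations) := by
  -- `a = A / D`
  obtain ⟨A, D, hA, hD, hDa⟩ : ∃ A D : ℕ, 0 < A ∧ 0 < D ∧ (D:ℚ) * a = A := by
    refine ⟨a.num.toNat, a.den, ?_, a.den_pos, ?_⟩
    · have := Rat.num_pos.mpr ha
      omega
    · rw [mul_comm, Rat.mul_den_eq_num, ← Int.cast_natCast,
        Int.toNat_of_nonneg (Rat.num_pos.mpr ha).le]
  refine ⟨A, A + D, hA, by omega, ?_⟩
  have hAq : (0:ℚ) < A := by exact_mod_cast hA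
  have hDq : (0:ℚ) < D := by exact_mod_cast hD
  -- dilate `(a, a+1)` by `D` onto `(A, A+D)`
  have hscale : of L - of (R A ((A + D : ℕ) : ℚ) c) ∈ relations :=
    dlog_scale_mem_relations (s := (D:ℚ)) L _ hd
      (by rw [mul_add, mul_one, hDa, ← Nat.cast_add]; exact (hR _ _ _ hAq).1)
      hi (fun x _ => by rw [(hR _ _ _ hAq).2]) ha hDq
  -- split `(1, A+D)` at `A`
  have hsplit : of (R 1 ((A + D : ℕ) : ℚ) c) - of (R 1 A c) - of (R A ((A + D : ℕ) : ℚ) c) ∈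
      relations :=
    split_mem_relations _ _ _ (hR _ _ _ one_pos).1 (hR _ _ _ one_pos).1 (hR _ _ _ hAq).1
      (by exact_mod_cast Nat.one_le_iff_ne_zero.mpr hA.ne') (by exact_mod_cast Nat.le_add_right A D)
      (fun x _ => by rw [(hR _ _ _ one_pos).2, (hR _ _ _ one_pos).2])
      (fun x _ => by rw [(hR _ _ _ hAq).2, (hR _ _ _ one_pos).2])
  have h := (QuotientAddGroup.eq_zero_iff _).mpr hsplit
  rw [QuotientAddGroup.mk_sub, QuotientAddGroup.mk_sub, sub_sub, sub_eq_zero] at h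
  rw [QuotientAddGroup.eq_iff_sub_mem.mpr hscale, h]
  abel

/-! ## The affine move onto the unit interval -/

/-- The reflection `y ↦ ρ − y` maps the slab `(ρ − 1, ρ)` onto `(0, 1)`. [folklore] -/
theorem image_reflect_slab (ρ : ℝ) :
    (fun y : Fin 1 → ℝ => fun _ : Fin 1 => (-1:ℝ) * y 0 + ρ) ''
        {x : Fin 1 → ℝ | x 0 ∈ Set.Ioo (ρ - 1) ρ} =
      {x : Fin 1 → ℝ | x 0 ∈ Set.Ioo (0:ℝ) 1} := by
  ext y
  constructor
  · rintro ⟨x, hx, rfl⟩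
    simp only [mem_setOf_eq, mem_Ioo] at hx ⊢
    obtain ⟨h0, h1⟩ := hx
    constructor <;> linarith
  · intro hy
    simp only [mem_setOf_eq, mem_Ioo] at hy
    obtain ⟨hy0, hy1⟩ := hy
    refine ⟨fun _ => ρ - y 0, ?_, ?_⟩
    · simp only [mem_setOf_eq, mem_Ioo]
      constructor <;> linarith
    · funext i
      obtain rfl : i = 0 := Fin.fin_one_eq_zero i
      show (-1:ℝ) * (ρ - y 0) + ρ = y 0
      ring

/-- **The translation move** (`ρ < 0`, rule 2): `y ↦ y + ρ` carries the dlog window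
`[(−ρ, −ρ+1), c/y]` onto `T = [(0,1), c/(x − ρ)]`, so `[(−ρ, −ρ+1), c/y] − [T] ∈ relations`.
[cite: KontsevichZagier2001, §1.2 rule (2)] -/
theorem window_sub_mem_relations_of_neg
    (hR : ∀ a b c, 0 < a → (R a b c).domain = {x | x 0 ∈ Set.Ioo (a:ℝ) b} ∧
      (R a b c).integrand = fun x => (c:ℝ) / x 0)
    {c ρ : ℚ} (hρ : ρ < 0) (T : IntegralRep 1) (hTd : T.domain = {x | x 0 ∈ Set.Ioo (0:ℝ) 1})
    (hTi : EqOn T.integrand (fun x => (c:ℝ) / (x 0 - ρ)) T.domain) :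
    of (R (-ρ) (-ρ + 1) c) - of T ∈ relations := by
  have ha : (0:ℚ) < -ρ := neg_pos.mpr hρ
  have hLd : (R (-ρ) (-ρ + 1) c).domain =
      {x : Fin 1 → ℝ | x 0 ∈ Set.Ioo ((0 - (ρ:ℝ)) / 1) ((1 - (ρ:ℝ)) / 1)} := by
    rw [(hR _ _ _ ha).1, show ((-ρ : ℚ) : ℝ) = (0 - (ρ:ℝ)) / 1 by push_cast; ring,
      show ((-ρ + 1 : ℚ) : ℝ) = (1 - (ρ:ℝ)) / 1 by push_cast; ring]
  have himage : T.domain =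
      (fun y : Fin 1 → ℝ => fun _ : Fin 1 => (1:ℝ) * y 0 + ρ) '' (R (-ρ) (-ρ + 1) c).domain := by
    rw [hLd, aff_image_chart one_pos (ρ:ℝ), hTd]
  refine changeOfVariablesRel_subset_relations
    ⟨1, R (-ρ) (-ρ + 1) c, T, fun y : Fin 1 → ℝ => fun _ : Fin 1 => (1:ℝ) * y 0 + ρ,
      fun _ => (1:ℝ) • ContinuousLinearMap.id ℝ (Fin 1 → ℝ),
      aff_isSemialgebraicMapOn_chart (R (-ρ) (-ρ + 1) c).isSemialgebraic_domain
        (isAlgebraic_algebraMap ρ) isAlgebraic_one,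
      fun x _ => (aff_hasFDerivAt_chart (1:ℝ) ρ x).hasFDerivWithinAt,
      (aff_injective_chart one_ne_zero (ρ:ℝ)).injOn, himage, fun x hx => ?_, rfl⟩
  have hΦx : (fun _ : Fin 1 => (1:ℝ) * x 0 + ρ) ∈ T.domain := himage ▸ Set.mem_image_of_mem _ hx
  rw [(hR _ _ _ ha).2, hTi hΦx, aff_abs_det_chartDeriv one_pos]
  simp only [one_mul, mul_one, add_sub_cancel_right]

/-- **The reflection move** (`ρ > 1`, rule 2): `y ↦ ρ − y` carries the dlog window
`[(ρ−1, ρ), (−c)/y]` onto `T = [(0,1), c/(x − ρ)]` (Jacobian `|det (−id)| = 1`), so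
`[(ρ−1, ρ), (−c)/y] − [T] ∈ relations`. [cite: KontsevichZagier2001, §1.2 rule (2)] -/
theorem window_sub_mem_relations_of_one_lt
    (hR : ∀ a b c, 0 < a → (R a b c).domain = {x | x 0 ∈ Set.Ioo (a:ℝ) b} ∧
      (R a b c).integrand = fun x => (c:ℝ) / x 0)
    {c ρ : ℚ} (hρ : 1 < ρ) (T : IntegralRep 1) (hTd : T.domain = {x | x 0 ∈ Set.Ioo (0:ℝ) 1})
    (hTi : EqOn T.integrand (fun x => (c:ℝ) / (x 0 - ρ)) T.domain) :
    of (R (ρ - 1) (ρ - 1 + 1) (-c)) - of T ∈ relations := by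
  have ha : (0:ℚ) < ρ - 1 := sub_pos.mpr hρ
  have hLd : (R (ρ - 1) (ρ - 1 + 1) (-c)).domain =
      {x : Fin 1 → ℝ | x 0 ∈ Set.Ioo ((ρ:ℝ) - 1) ρ} := by
    rw [(hR _ _ _ ha).1, show ((ρ - 1 : ℚ) : ℝ) = (ρ:ℝ) - 1 by push_cast; ring,
      show ((ρ - 1 + 1 : ℚ) : ℝ) = (ρ:ℝ) by push_cast; ring]
  have himage : T.domain = (fun y : Fin 1 → ℝ => fun _ : Fin 1 => (-1:ℝ) * y 0 + ρ) ''
      (R (ρ - 1) (ρ - 1 + 1) (-c)).domain := by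
    rw [hLd, image_reflect_slab, hTd]
  -- the Jacobian of the reflection
  have hdet : |((-1:ℝ) • ContinuousLinearMap.id ℝ (Fin 1 → ℝ)).det| = 1 := by
    have : ((-1:ℝ) • ContinuousLinearMap.id ℝ (Fin 1 → ℝ)).det = -1 := by
      change LinearMap.det (((-1:ℝ) • ContinuousLinearMap.id ℝ (Fin 1 → ℝ) :
        (Fin 1 → ℝ) →L[ℝ] (Fin 1 → ℝ)) : (Fin 1 → ℝ) →ₗ[ℝ] (Fin 1 → ℝ)) = -1
      rw [ContinuousLinearMap.toLinearMap_smul, ContinuousLinearMap.coe_id,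
        LinearMap.det_smul, LinearMap.det_id, Module.finrank_fin_fun]
      ring
    rw [this, abs_neg, abs_one]
  refine changeOfVariablesRel_subset_relations
    ⟨1, R (ρ - 1) (ρ - 1 + 1) (-c), T, fun y : Fin 1 → ℝ => fun _ : Fin 1 => (-1:ℝ) * y 0 + ρ,
      fun _ => (-1:ℝ) • ContinuousLinearMap.id ℝ (Fin 1 → ℝ),
      aff_isSemialgebraicMapOn_chart (R (ρ - 1) (ρ - 1 + 1) (-c)).isSemialgebraic_domain
        (isAlgebraic_algebraMap ρ) isAlgebraic_one.neg,
      fun x _ => (aff_hasFDerivAt_chart (-1:ℝ) ρ x).hasFDerivWithinAt,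
      (aff_injective_chart (neg_ne_zero.mpr one_ne_zero) (ρ:ℝ)).injOn, himage,
      fun x hx => ?_, rfl⟩
  have hΦx : (fun _ : Fin 1 => (-1:ℝ) * x 0 + ρ) ∈ T.domain := himage ▸ Set.mem_image_of_mem _ hx
  rw [(hR _ _ _ ha).2, hTi hΦx, hdet]
  have hx : (-1:ℝ) * x 0 + (ρ:ℝ) - ρ = -(x 0) := by ring
  simp only [hx, mul_one, div_neg]
  push_cast
  rw [neg_div]

/-! ## The registered sub-goal -/

/-- **Registered sub-goal `nf_pole_one`** (crux stmt-KontsevichZagierPeriods-3869, line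
`SketchIdeator1`, split-denominator layer of `stub_boxRigidity`): a simple rational pole
`T = [(0,1), c/(x − ρ)]` with `ρ ∈ ℚ ∖ [0,1]` is, modulo `KZ.relations`, in the normal form
"rational point + prime carriers": `[T] = [pt, r] + Σ_{p ∈ S} [(1,p), C_p/y]` with `S` a finite
set of primes and `C` supported on `S` (here `r = 0`, `S = primeFactors A ∪ primeFactors B`,
`C_p = (v_p(B) − v_p(A)) c'` where `[(a,a+1), c'/y]` is the window of `T` and `a = A/D`,
`B = A + D`). One affine move, one dilation, one split, merging, and the finite certificate
`eq_sum_primeFactors_of_map_mul`. [cite: KontsevichZagier2001, §1.1, §1.2 rules (1), (2)] -/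
theorem nf_pole_one {R : ℚ → ℚ → ℚ → IntegralRep 1} {Z : ℚ → IntegralRep 0} (hR : ∀ a b c, 0 < a → (R a b c).domain = {x | x 0 ∈ Set.Ioo (a:ℝ) b} ∧ (R a b c).integrand = fun x => (c:ℝ) / x 0) (hZ : ∀ r, (Z r).domain = univ ∧ (Z r).integrand = fun _ => (r:ℝ)) {c ρ : ℚ} (hρ : (ρ:ℝ) ∉ Set.Icc (0:ℝ) 1) (T : IntegralRep 1) (hTd : T.domain = {x | x 0 ∈ Set.Ioo (0:ℝ) 1}) (hTi : EqOn T.integrand (fun x => (c:ℝ) / (x 0 - ρ)) T.domain) : ∃ (r : ℚ) (S : Finset ℕ) (C : ℕ → ℚ), (∀ p ∈ S, p.Prime) ∧ (∀ p, p ∉ S → C p = 0) ∧ QuotientAddGroup.mk' relations (of T) = QuotientAddGroup.mk' relations (of (Z r)) + ∑ p ∈ S, QuotientAddGroup.mk' relations (of (R 1 p (C p))) := by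
  -- Step 1: one affine move onto a dlog window `[(a, a+1), c'/y]`, `a > 0`
  obtain ⟨a, c', ha, hwin⟩ : ∃ a c' : ℚ, 0 < a ∧ (of T : FormalRep ⧸ relations) =
      (of (R a (a + 1) c') : FormalRep ⧸ relations) := by
    have hρ' : ρ < 0 ∨ 1 < ρ := by
      by_cases h : ρ < 0
      · exact Or.inl h
      · by_cases h1 : 1 < ρ
        · exact Or.inr h1
        · exact absurd ⟨by exact_mod_cast not_lt.mp h, by exact_mod_cast not_lt.mp h1⟩ hρ
    rcases hρ' with h | h
    · exact ⟨-ρ, c, neg_pos.mpr h, (QuotientAddGroup.eq_iff_sub_mem.mpr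
        (window_sub_mem_relations_of_neg hR h T hTd hTi)).symm⟩
    · exact ⟨ρ - 1, -c, sub_pos.mpr h, (QuotientAddGroup.eq_iff_sub_mem.mpr
        (window_sub_mem_relations_of_one_lt hR h T hTd hTi)).symm⟩
  -- Step 2: integer carriers `[(a, a+1), c'/y] = Λ(B) − Λ(A)`
  obtain ⟨A, B, hA, hB, hAB⟩ := exists_nat_window hR ha (R a (a + 1) c') (hR _ _ _ ha).1
    (fun x _ => by rw [(hR _ _ _ ha).2])
  -- Step 3: the finite certificate `Λ(n) = Σ_p v_p(n) • Λ(p)`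
  have hcore : ∀ n : ℕ, 0 < n → (of (R 1 n c') : FormalRep ⧸ relations) =
      ∑ p ∈ n.primeFactors, n.factorization p • (of (R 1 p c') : FormalRep ⧸ relations) :=
    fun n hn => eq_sum_primeFactors_of_map_mul
      (fun k : ℕ => (of (R 1 k c') : FormalRep ⧸ relations))
      (by simp only [Nat.cast_one]; exact mk_carrier_self hR one_pos c')
      (fun m k hm hk => mk_carrier_mul hR c' hm hk) hn
  -- Step 4: assemble the normal form
  refine ⟨0, A.primeFactors ∪ B.primeFactors,
    fun p => ((B.factorization p : ℚ) - (A.factorization p : ℚ)) * c', ?_, ?_, ?_⟩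
  · intro p hp
    rcases Finset.mem_union.mp hp with h | h <;> exact Nat.prime_of_mem_primeFactors h
  · intro p hp
    rw [Finset.mem_union, not_or] at hp
    have h1 : A.factorization p = 0 :=
      Finsupp.notMem_support_iff.mp (by rw [Nat.support_factorization]; exact hp.1)
    have h2 : B.factorization p = 0 :=
      Finsupp.notMem_support_iff.mp (by rw [Nat.support_factorization]; exact hp.2)
    simp [h1, h2]
  · have hZ0 : (of (Z 0) : FormalRep ⧸ relations) = 0 := (QuotientAddGroup.eq_zero_iff _).mpr
      (of_mem_relations_of_eqOn_zero _ fun x _ => by simp [(hZ 0).2])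
    simp only [QuotientAddGroup.mk'_apply]
    rw [hZ0, zero_add, hwin, hAB, hcore B hB, hcore A hA]
    simp_rw [mk_carrier_sub_natMul hR one_pos]
    rw [Finset.sum_sub_distrib]
    congr 1
    · exact Finset.sum_subset Finset.subset_union_right fun p _ hp => by
        rw [Finsupp.notMem_support_iff.mp (by rwa [Nat.support_factorization]), zero_nsmul]
    · exact Finset.sum_subset Finset.subset_union_left fun p _ hp => by
        rw [Finsupp.notMem_support_iff.mp (by rwa [Nat.support_factorization]), zero_nsmul]

end Summit.KontsevichZagierPeriods.HurwitzMicroSectors.NormalFormPrinciple.PiBox.Dlog.SiegeK24
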